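import Summits.HodgeConjecture.HodgeConjecture.Theorems.Ring2BindersAbelianSchemeVHCMiddleLift
import Summits.HodgeConjecture.HodgeConjecture.Theorems.Ring2BindersAbelianSchemeVHCHalving
import Literature.AlgebraicGeometry.Motives.AbelianVarietyExistence
import HarnessLib

/-!
# Ring 2 — binder seat b02 (Hodge ladder stage 3): row b02 `AbelianSchemeVHC` IS ITS MIDDLE DEGREE — the variational
# Hodge conjecture for abelian schemes is its restriction to the cells `(2q, q)` (even relative dimension `2q`, middle
# codimension `q`), modulo the print residual only; glued with the rungs, its content is the diagonal `q ≥ 2`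

HONEST FRAMING: research route conditional on HC_CM; not a corollary; Q11.4-sentence-2 already refuted in dim ≥ 3.

Cell `pub-hodge-ring2`, binder seat `ring2-b02`, row b02 of `BINDER-OWNERS.md` (`Ring2.Hypotheses.AbelianSchemeVHC`,
`Theorems/Ring2Hypotheses.lean`; OPEN, print-equivalent to `HC_AV`, nothing to discharge). `HC_CM`
(`Theses.RankFourFaces.CMAbelianHodge`) does not occur below; nothing here is a case of the Hodge conjecture; no
`sorry`, no definition, no NEW Literature fact, no node; «10 · 0» untouched.

WHAT THIS PART SETTLES. The halving part (`Ring2BindersAbelianSchemeVHCHalving.lean`, p246317) proved that row b02 IS its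
LOWER HALF `2p ≤ n` modulo the print residual N97 / c20, so that its content starts at the TWO-parameter family of cells
`(n, p)`, `n ≥ 4`, `2 ≤ p ≤ n/2`. With the middle lift of `Ring2BindersAbelianSchemeVHCMiddleLift.lean` (pad the family
by a constant abelian variety `B` of dimension `n - 2p`, lift `W` to `pr_𝒳^*(Kʳ ∪ W)` in the MIDDLE degree of
`𝒳 × B ⟶ S`, same algebraicity locus; fact-free on quasi-projective carriers) that family collapses to its DIAGONAL —
the variational analogue of AbelianAll part XV `HC_AV_iff_forall_middleDegree` and of row b05's middle-codimension form:

* §1 `map_fiberι_mem_algebraicClasses_of_middleDegree` — **the MIDDLE DEGREE of row b02 gives the conclusion of row b02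
  on every carrier with quasi-projective total space over a smooth irreducible quasi-projective base, in every
  codimension, FACT-FREE** (above the middle: the lower shadow; below: the middle lift, `B` a power of an elliptic
  curve, `exists_abelianVariety_dim_eq_succ`); hence `oneParameterAbelianSchemeVHCGerm_of_middleDegree`, the germ form
  on one-parameter abelian schemes, FACT-FREE.
* §2 **`abelianSchemeVHC_iff_middleDegree_of_oneParameterAbelianSchemeQuasiProjective`** /
  **`abelianSchemeVHC_iff_middleDegree_of_raynaud1970`**: row b02 `AbelianSchemeVHC` ⟺ `AbelianSchemeVHCMiddleDegree`
  (the row with the binder `2p = n` inserted), modulo N97 / modulo c20.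
* §3 glued with the rungs: **row b02 IS its restriction to the diagonal cells `(2q, q)`, `q ≥ 2`**
  (`abelianSchemeVHC_iff_middleDegreeFrom_four_of_raynaud1970`: `(4,2)`, `(6,3)`, `(8,4)`, …; the halving part's
  `(5,2)`, `(6,2)`, `(7,2)`, `(7,3)`, … are dominated), `HCUpToDim g ⟹ (row b02 ⟺ the cells (2q, q), 2q ≥ g + 1)`
  (`abelianSchemeVHC_iff_middleDegreeFrom_of_hcUpToDim`); so modulo {c20, c9 Moonen–Zarhin, c28 Markman} the binder's
  content starts at the SINGLE cell `(6, 3)` (the halving part had `(6, 2)` too, now sent to `(8, 4)`); and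
  `HC_AV ⟺ AbelianSchemeVHCMiddleDegreeFrom[4]` modulo {c11, c12, c20}, no `HC_CM`.

What is NOT claimed: any case of `AbelianSchemeVHC` or of HC; anything about `HC_CM`; the residual (N97 / c20 are
HYPOTHESES wherever used, never asserted); a reduction to Lefschetz-PRIMITIVE middle classes. The graded statements are
FILE-LOCAL NOTATIONS, symbol for symbol the body of `Ring2.Hypotheses.AbelianSchemeVHC` with binders inserted
(`AbelianSchemeVHCUpTo[g]` verbatim the rungs part's, whose `AbelianSchemeVHCMiddleFrom[g]` — the middle RANGE
`2 ≤ p ≤ n - 2` — is a different statement from this file's `AbelianSchemeVHCMiddleDegreeFrom[g]`, the middle DEGREE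
`2p = n`). Row b02 stays OPEN ≡ `HC_AV` modulo print.

References: [Grothendieck1966] footnote 13; [CharlesSchnell2014Notes] Conj. 11.3.1, Cor. 11.3.6, Prop. 11.3.11;
[BrosnanFangNiePearlstein2009] §6 Lemma 48; [VoisinHodgeI2002] Thm. 6.25, Rem. 6.27, Thm. 11.30; [VoisinHodgeII2003]
Thm. 4.18, §10.2.3; [KerrPearlstein2011] §3.1; [Lieberman1968] main theorem; [GortzWedhorn2023] Thm. 27.291;
[LaurentSchroer2023] Prop. 4.3; [Raynaud1970] XI 1.4 (not held, acq-09263); [MoonenZarhin1999LowDim] Thms. 0.1–0.2;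
[Markman2025SecantWeil] Cor. 1.6.1 (unrefereed); [Andre1996Motifs] §6.3; [SilvermanAEC2009] III.3.6.
-/

-- every declaration of this problem lives in `Summit.HodgeConjecture.HodgeConjecture.…` (summit = sub-problem);
-- namespace `…Ring2.Binders` = the binder seats of the cell's Hodge-ladder stage 3 (`BINDER-OWNERS.md`)
set_option linter.dupNamespace false

noncomputable section

open CategoryTheory CategoryTheory.Limits AlgebraicGeometry Topology MonoidalCategory CartesianMonoidalCategory
open Literature.AlgebraicGeometry Literature.AlgebraicGeometry.Motives
open Literature.AlgebraicGeometry.HodgeTheory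
open Literature.AlgebraicGeometry.Andre1996 (andre1996_cmAnchoredPencil
  andre1996_cmHodgeClasses_algebraicallyAnchoredPencils)

namespace Summit.HodgeConjecture.HodgeConjecture.Ring2.Binders

open Summit.HodgeConjecture.HodgeConjecture.Ring2.Hypotheses
open Summit.HodgeConjecture.HodgeConjecture.Ring2.ClassTargets

variable {𝒳 S : SchemeOver ℂ}

/-! ## §0 The graded statements (file-local notations; nothing is defined or asserted) -/

/-- Row b02 restricted to the MIDDLE codimension `2p = n` (file-local notation; symbol for symbol the body of
`Ring2.Hypotheses.AbelianSchemeVHC` with the binder `2 * p = n` inserted; vacuous in odd relative dimension). -/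
local notation3 (prettyPrint := false) "AbelianSchemeVHCMiddleDegree" =>
  ∀ ⦃n : ℕ⦄ ⦃𝒳 S : SchemeOver ℂ⦄ (f : 𝒳 ⟶ S), IsSmoothProjectiveFamily f n → IrreducibleSpace S.left →
    AlgebraicGeometry.Smooth S.hom →
    (∀ s : ComplexPoints S, ∃ A' : AbelianVariety ℂ, A'.dim = n ∧ Nonempty (A'.X ≅ fiberOver f s)) →
    ∀ (p : ℕ), 2 * p = n → ∀ (W : complexBetti 𝒳 (2 * p)),
      (∀ s : ComplexPoints S, IsRationalClass (complexBetti.map (fiberι f s) (2 * p) W) ∧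
        IsOfHodgeType n (fiberOver f s) (2 * p) p p (complexBetti.map (fiberι f s) (2 * p) W)) →
      (∃ s₀ : ComplexPoints S,
        complexBetti.map (fiberι f s₀) (2 * p) W ∈ algebraicClasses (fiberOver f s₀) p) →
      ∀ s : ComplexPoints S, complexBetti.map (fiberι f s) (2 * p) W ∈ algebraicClasses (fiberOver f s) p

/-- Row b02 restricted to relative dimension `n ≥ g` AND the middle codimension `2p = n` (file-local notation): the
cells `(2q, q)` with `2q ≥ g`. -/
local notation3 (prettyPrint := false) "AbelianSchemeVHCMiddleDegreeFrom[" g "]" =>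
  ∀ ⦃n : ℕ⦄ ⦃𝒳 S : SchemeOver ℂ⦄ (f : 𝒳 ⟶ S), IsSmoothProjectiveFamily f n → g ≤ n → IrreducibleSpace S.left →
    AlgebraicGeometry.Smooth S.hom →
    (∀ s : ComplexPoints S, ∃ A' : AbelianVariety ℂ, A'.dim = n ∧ Nonempty (A'.X ≅ fiberOver f s)) →
    ∀ (p : ℕ), 2 * p = n → ∀ (W : complexBetti 𝒳 (2 * p)),
      (∀ s : ComplexPoints S, IsRationalClass (complexBetti.map (fiberι f s) (2 * p) W) ∧
        IsOfHodgeType n (fiberOver f s) (2 * p) p p (complexBetti.map (fiberι f s) (2 * p) W)) →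
      (∃ s₀ : ComplexPoints S,
        complexBetti.map (fiberι f s₀) (2 * p) W ∈ algebraicClasses (fiberOver f s₀) p) →
      ∀ s : ComplexPoints S, complexBetti.map (fiberι f s) (2 * p) W ∈ algebraicClasses (fiberOver f s) p

/-- Row b02 restricted to relative dimension `n ≤ g` (file-local notation; verbatim the notation of the rungs part,
so that its lemmas `abelianSchemeVHC_upTo_three`, `abelianSchemeVHC_upTo_of_hcUpToDim` are consumed by name). -/
local notation3 (prettyPrint := false) "AbelianSchemeVHCUpTo[" g "]" =>
  ∀ ⦃n : ℕ⦄ ⦃𝒳 S : SchemeOver ℂ⦄ (f : 𝒳 ⟶ S), IsSmoothProjectiveFamily f n → n ≤ g → IrreducibleSpace S.left →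
    AlgebraicGeometry.Smooth S.hom →
    (∀ s : ComplexPoints S, ∃ A' : AbelianVariety ℂ, A'.dim = n ∧ Nonempty (A'.X ≅ fiberOver f s)) →
    ∀ (p : ℕ) (W : complexBetti 𝒳 (2 * p)),
      (∀ s : ComplexPoints S, IsRationalClass (complexBetti.map (fiberι f s) (2 * p) W) ∧
        IsOfHodgeType n (fiberOver f s) (2 * p) p p (complexBetti.map (fiberι f s) (2 * p) W)) →
      (∃ s₀ : ComplexPoints S,
        complexBetti.map (fiberι f s₀) (2 * p) W ∈ algebraicClasses (fiberOver f s₀) p) →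
      ∀ s : ComplexPoints S, complexBetti.map (fiberι f s) (2 * p) W ∈ algebraicClasses (fiberOver f s) p

/-! ## §1 The middle degree of row b02 gives row b02 on every quasi-projective carrier, fact-free -/

/-- Restriction: row b02 gives its middle (forget the binder `2p = n`). [folklore] -/
theorem abelianSchemeVHCMiddleDegree_of_abelianSchemeVHC (h : AbelianSchemeVHC) : AbelianSchemeVHCMiddleDegree := by
  intro n 𝒳 S f hf hirr hsm habel p _ W hW h₀ s
  exact h f hf hirr hsm habel p W hW h₀ s

/-- **The MIDDLE of row b02 gives the conclusion of row b02 on every carrier with quasi-projective total space over a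
smooth irreducible quasi-projective base, in EVERY codimension — FACT-FREE.** Above the middle pass to the lower
shadow (the shadow part's `map_fiberι_mem_algebraicClasses_of_lowerHalf`); in codimension `2q < n` pad by an abelian
variety `B` of dimension `n - 2q` (`exists_abelianVariety_dim_eq_succ`, powers of an elliptic curve) and apply the
middle of row b02 to `𝒳 × B ⟶ S` and the middle lift `W♯` (`exists_middleLift`), whose algebraicity locus is that of `W`.
[cite: BrosnanFangNiePearlstein2009, §6 Lemma 48] [cite: KerrPearlstein2011, §3.1] [cite: Lieberman1968, main theorem]
[cite: SilvermanAEC2009, III.3.6] -/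
theorem map_fiberι_mem_algebraicClasses_of_middleDegree (h : AbelianSchemeVHCMiddleDegree) (f : 𝒳 ⟶ S) {n : ℕ}
    (hf : IsSmoothProjectiveFamily f n) (h𝒳 : IsQuasiProjectiveOver 𝒳) (hS : IsQuasiProjectiveOver S)
    [IrreducibleSpace S.left] (hSs : AlgebraicGeometry.Smooth S.hom)
    (hA : ∀ s : ComplexPoints S, ∃ A' : AbelianVariety ℂ, A'.dim = n ∧ Nonempty (A'.X ≅ fiberOver f s))
    (p : ℕ) (W : complexBetti 𝒳 (2 * p))
    (hW : ∀ s : ComplexPoints S, IsRationalClass (complexBetti.map (fiberι f s) (2 * p) W) ∧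
      IsOfHodgeType n (fiberOver f s) (2 * p) p p (complexBetti.map (fiberι f s) (2 * p) W))
    {s₀ : ComplexPoints S} (h₀ : complexBetti.map (fiberι f s₀) (2 * p) W ∈ algebraicClasses (fiberOver f s₀) p)
    (s : ComplexPoints S) : complexBetti.map (fiberι f s) (2 * p) W ∈ algebraicClasses (fiberOver f s) p := by
  haveI : IsSeparated S.hom := hS.isSeparated
  refine map_fiberι_mem_algebraicClasses_of_lowerHalf f hf h𝒳 hS hSs hA Set.univ (fun q hq W' hW' h₀' t _ ↦ ?_)
    p W hW h₀ s (Set.mem_univ s)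
  rcases Nat.eq_or_lt_of_le hq with hqn | hqn
  · -- the cell is already in the middle
    exact h f hf ‹_› hSs hA q hqn W' hW' ⟨s₀, h₀'⟩ t
  · -- pad by an abelian variety of dimension `n - 2q ≥ 1` and lift `W'` to the middle of `𝒳 × B ⟶ S`
    obtain ⟨B, hB⟩ := exists_abelianVariety_dim_eq_succ ℂ (n - 2 * q - 1)
    have hqB : 2 * q + B.dim = n := by omega
    obtain ⟨hf', hA', W'', hW'', hiff⟩ := exists_middleLift f hf h𝒳 hA B hqB W' hW'
    exact (hiff t).1 (h _ hf' ‹_› hSs hA' (q + B.dim) (by omega) W'' hW'' ⟨s₀, (hiff s₀).2 h₀'⟩ t)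

/-- **The middle of row b02 gives the germ form `OneParameterAbelianSchemeVHCGerm` — FACT-FREE** (the germ form's
carriers have quasi-projective total space over an affine, hence quasi-projective, curve; the open set is all of
`S(ℂ)`). [cite: CharlesSchnell2014Notes, Conj. 11.3.1] [cite: BrosnanFangNiePearlstein2009, §6 Lemma 48]
[cite: Lieberman1968, main theorem] -/
theorem oneParameterAbelianSchemeVHCGerm_of_middleDegree (h : AbelianSchemeVHCMiddleDegree) : OneParameterAbelianSchemeVHCGerm := by
  intro n 𝒳 S f hf h𝒳 hirr haff hsm _ habel _ p W hW s₀ hs₀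
  haveI := hirr
  haveI := haff
  haveI := hsm
  haveI : LocallyOfFiniteType S.hom := inferInstance
  exact ⟨Set.univ, isOpen_univ, Set.mem_univ _, fun s _ ↦ map_fiberι_mem_algebraicClasses_of_middleDegree h f hf h𝒳
    (IsQuasiProjectiveOver.of_isAffine S) hsm habel p W hW hs₀ s⟩

/-! ## §2 The binder: row b02 IS its middle degree, modulo the print residual only -/

/-- **EXACTNESS modulo the curve print residual: row b02 `AbelianSchemeVHC` ⟺ its MIDDLE** — the variational Hodge
conjecture for abelian schemes is its own restriction to the middle codimension `2p = n` of the families of even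
relative dimension, granted only `OneParameterAbelianSchemeQuasiProjective` (N97; used in `←`, through part (v7)'s
`abelianSchemeVHC_iff_germ_of_oneParameterAbelianSchemeQuasiProjective`). [cite: CharlesSchnell2014Notes, Conj. 11.3.1 and Prop. 11.3.11 (proof)]
[cite: BrosnanFangNiePearlstein2009, §6 Lemma 48] [cite: Lieberman1968, main theorem] [cite: GortzWedhorn2023, Thm. 27.291] -/
theorem abelianSchemeVHC_iff_middleDegree_of_oneParameterAbelianSchemeQuasiProjective
    (hqp : OneParameterAbelianSchemeQuasiProjective) : AbelianSchemeVHC ↔ AbelianSchemeVHCMiddleDegree :=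
  ⟨abelianSchemeVHCMiddleDegree_of_abelianSchemeVHC, fun h ↦
    (abelianSchemeVHC_iff_germ_of_oneParameterAbelianSchemeQuasiProjective hqp).2
      (oneParameterAbelianSchemeVHCGerm_of_middleDegree h)⟩

/-- **EXACTNESS modulo Raynaud's theorem as booked (`raynaud1970_abelianScheme_section_projective`, c20): row b02
⟺ its middle.** CONDITIONAL on the named fact (used in `←` only). [cite: GortzWedhorn2023, §(27.53) Thm. 27.291]
[cite: LaurentSchroer2023, §4 Prop. 4.3] [cite: CharlesSchnell2014Notes, Conj. 11.3.1] [cite: Lieberman1968, main theorem] -/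
theorem abelianSchemeVHC_iff_middleDegree_of_raynaud1970 (hR : raynaud1970_abelianScheme_section_projective) :
    AbelianSchemeVHC ↔ AbelianSchemeVHCMiddleDegree :=
  abelianSchemeVHC_iff_middleDegree_of_oneParameterAbelianSchemeQuasiProjective
    (oneParameterAbelianSchemeQuasiProjective_of_raynaud1970 hR)

/-! ## §3 Glued with the rungs: the content of row b02 is the diagonal `(2q, q)`, `q ≥ 2` -/

/-- **GLUING: a dimension slice `n ≤ g` and the middle cells from `n ≥ g + 1` on give the middle of row b02**,
unconditionally. [folklore] -/
theorem abelianSchemeVHCMiddleDegree_of_upTo_of_middleDegreeFrom {g : ℕ} (h₁ : AbelianSchemeVHCUpTo[g])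
    (h₂ : AbelianSchemeVHCMiddleDegreeFrom[g + 1]) : AbelianSchemeVHCMiddleDegree := by
  intro n 𝒳 S f hf hirr hsm habel p hpn W hW h₀ s
  rcases Nat.lt_or_ge g n with hgn | hng
  · exact h₂ f hf (by omega) hirr hsm habel p hpn W hW h₀ s
  · exact h₁ f hf hng hirr hsm habel p W hW h₀ s

/-- Restriction: row b02 gives its middle cells from any relative dimension `g` on. [folklore] -/
theorem abelianSchemeVHCMiddleDegreeFrom_of_abelianSchemeVHC (g : ℕ) (h : AbelianSchemeVHC) :
    AbelianSchemeVHCMiddleDegreeFrom[g] := by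
  intro n 𝒳 S f hf _ hirr hsm habel p _ W hW h₀ s
  exact h f hf hirr hsm habel p W hW h₀ s

/-- **`HCUpToDim g ⟹ (row b02 ⟺ its restriction to the middle cells `(2q, q)` with `2q ≥ g + 1`)**, modulo the
curve print residual: the class target closes the slices `n ≤ g` (rungs §1 `abelianSchemeVHC_upTo_of_hcUpToDim`), the
padding and the shadow close everything off the middle. [cite: CharlesSchnell2014Notes, Cor. 11.3.6]
[cite: BrosnanFangNiePearlstein2009, §6 Lemma 48] [cite: Lieberman1968, main theorem] -/
theorem abelianSchemeVHC_iff_middleDegreeFrom_of_hcUpToDim (hqp : OneParameterAbelianSchemeQuasiProjective) {g : ℕ}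
    (h : HCUpToDim g) : AbelianSchemeVHC ↔ AbelianSchemeVHCMiddleDegreeFrom[g + 1] :=
  ⟨abelianSchemeVHCMiddleDegreeFrom_of_abelianSchemeVHC (g + 1), fun h₂ ↦
    (abelianSchemeVHC_iff_middleDegree_of_oneParameterAbelianSchemeQuasiProjective hqp).2
      (abelianSchemeVHCMiddleDegree_of_upTo_of_middleDegreeFrom (abelianSchemeVHC_upTo_of_hcUpToDim h) h₂)⟩

/-- **Row b02 IS its restriction to the DIAGONAL cells `(2q, q)`, `q ≥ 2`** — families of abelian varieties of even
relative dimension `2q ≥ 4`, classes of the middle codimension `q` —, modulo the curve print residual (the slices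
`n ≤ 3` are the rungs' unconditional `abelianSchemeVHC_upTo_three`). First cells with content: `(4, 2)`, `(6, 3)`,
`(8, 4)`, …. [cite: BrosnanFangNiePearlstein2009, §6 Lemma 48] [cite: KerrPearlstein2011, §3.1] [cite: Lieberman1968, main theorem] -/
theorem abelianSchemeVHC_iff_middleDegreeFrom_four_of_oneParameterAbelianSchemeQuasiProjective
    (hqp : OneParameterAbelianSchemeQuasiProjective) : AbelianSchemeVHC ↔ AbelianSchemeVHCMiddleDegreeFrom[4] :=
  ⟨abelianSchemeVHCMiddleDegreeFrom_of_abelianSchemeVHC 4, fun h₂ ↦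
    (abelianSchemeVHC_iff_middleDegree_of_oneParameterAbelianSchemeQuasiProjective hqp).2
      (abelianSchemeVHCMiddleDegree_of_upTo_of_middleDegreeFrom abelianSchemeVHC_upTo_three h₂)⟩

/-- The same modulo Raynaud's theorem as booked (c20). CONDITIONAL on the named fact (used in `←` only).
[cite: GortzWedhorn2023, §(27.53) Thm. 27.291] [cite: BrosnanFangNiePearlstein2009, §6 Lemma 48] [cite: Lieberman1968, main theorem] -/
theorem abelianSchemeVHC_iff_middleDegreeFrom_four_of_raynaud1970 (hR : raynaud1970_abelianScheme_section_projective) :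
    AbelianSchemeVHC ↔ AbelianSchemeVHCMiddleDegreeFrom[4] :=
  abelianSchemeVHC_iff_middleDegreeFrom_four_of_oneParameterAbelianSchemeQuasiProjective
    (oneParameterAbelianSchemeQuasiProjective_of_raynaud1970 hR)

/-- **Modulo Raynaud (c20), Markman's Weil-fourfold claim (c28) and Moonen–Zarhin (c9), row b02 IS its restriction to
the diagonal cells `(2q, q)` with `q ≥ 3`**: the FIRST cell of the binder not covered is the single cell
`(n, p) = (6, 3)` (the halving part had `(6, 2)` as well, now sent to `(8, 4)`). All three inputs displayed as
hypotheses. [cite: MoonenZarhin1999LowDim, Thms. 0.1–0.2] [cite: Markman2025SecantWeil, Cor. 1.6.1 (unrefereed)]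
[cite: GortzWedhorn2023, Thm. 27.291] [cite: BrosnanFangNiePearlstein2009, §6 Lemma 48] -/
theorem abelianSchemeVHC_iff_middleDegreeFrom_six_of_weilClassesFourfolds_of_moonenZarhin_of_raynaud1970
    (hR : raynaud1970_abelianScheme_section_projective) (hW : Markman2025_weilClasses_algebraic_abelianFourfold)
    (hMZ : MoonenZarhin1999_hodgeClasses_abelian_dim_le_five_of_weilClassesFourfolds) :
    AbelianSchemeVHC ↔ AbelianSchemeVHCMiddleDegreeFrom[6] :=
  abelianSchemeVHC_iff_middleDegreeFrom_of_hcUpToDim (oneParameterAbelianSchemeQuasiProjective_of_raynaud1970 hR)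
    (hcUpToDim_five_of_weilClassesFourfolds_of_moonenZarhin hW hMZ)

/-- The same granted the support item `HodgeAbelianDimLeFive` of route `SevenfoldWeilCensus` (stmt-HodgeConjecture-18723)
by name, modulo Raynaud (c20). [cite: Markman2025SurveySecant, Cor. 1.3 (unrefereed)] [cite: GortzWedhorn2023, Thm. 27.291] -/
theorem abelianSchemeVHC_iff_middleDegreeFrom_six_of_hodgeAbelianDimLeFive_of_raynaud1970
    (hR : raynaud1970_abelianScheme_section_projective) (h₅ : Theses.SevenfoldWeilCensus.HodgeAbelianDimLeFive) :
    AbelianSchemeVHC ↔ AbelianSchemeVHCMiddleDegreeFrom[6] :=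
  abelianSchemeVHC_iff_middleDegreeFrom_of_hcUpToDim (oneParameterAbelianSchemeQuasiProjective_of_raynaud1970 hR)
    (hcUpToDim_five_iff_hodgeAbelianDimLeFive.mpr h₅)

/-- **`HC_AV` ⟺ the diagonal cells `(2q, q)`, `q ≥ 2`, of row b02**, modulo André 1996 #21/#22 (c11, c12) and Raynaud
(c20): deform IV's (E₂′) `Deform.HC_AV_iff_abelianSchemeVHC_of_andre1996` composed with §3. No `HC_CM`.
[cite: Andre1996Motifs, §6.3 Lemmes 6.3.1–6.3.3] [cite: BrosnanFangNiePearlstein2009, §6 Lemma 48] [cite: Lieberman1968, main theorem] -/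
theorem hc_av_iff_abelianSchemeVHCMiddleDegreeFrom_four_of_andre1996_of_raynaud1970
    (h₂₁ : andre1996_cmAnchoredPencil) (h₂₂ : andre1996_cmHodgeClasses_algebraicallyAnchoredPencils)
    (hR : raynaud1970_abelianScheme_section_projective) :
    Theses.PadicSemiregularLift.HodgeAbelianVarieties ↔ AbelianSchemeVHCMiddleDegreeFrom[4] :=
  (Deform.HC_AV_iff_abelianSchemeVHC_of_andre1996 h₂₁ h₂₂).trans
    (abelianSchemeVHC_iff_middleDegreeFrom_four_of_raynaud1970 hR)

/-! ## Audit: what the kernel now says about row b02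

`AbelianSchemeVHCMiddleDegree →` row b02 on quasi-projective carriers / `→ OneParameterAbelianSchemeVHCGerm`
FACT-FREE (§1); `AbelianSchemeVHC ↔ AbelianSchemeVHCMiddleDegree` and `↔ AbelianSchemeVHCMiddleDegreeFrom[4]` modulo N97 / c20
displayed as hypotheses (§2–§3); `HC_CM` does not occur; route items and the facts c9, c11, c12, c28 enter by name as
hypotheses only. Closures below are the three standard axioms. -/

#print axioms Summit.HodgeConjecture.HodgeConjecture.Ring2.Binders.map_fiberι_mem_algebraicClasses_of_middleDegree
#print axioms Summit.HodgeConjecture.HodgeConjecture.Ring2.Binders.abelianSchemeVHC_iff_middleDegree_of_raynaud1970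
#print axioms Summit.HodgeConjecture.HodgeConjecture.Ring2.Binders.abelianSchemeVHC_iff_middleDegreeFrom_four_of_raynaud1970
#print axioms Summit.HodgeConjecture.HodgeConjecture.Ring2.Binders.hc_av_iff_abelianSchemeVHCMiddleDegreeFrom_four_of_andre1996_of_raynaud1970

end Summit.HodgeConjecture.HodgeConjecture.Ring2.Binders

end
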